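import Summits.BirchSwinnertonDyer.BirchSwinnertonDyer.Theorems.ManinLocalTwoThreeVertexLeaf
import Summits.BirchSwinnertonDyer.BirchSwinnertonDyer.Theorems.ManinLocalTwoThreeVertexExtensionOdd
import Summits.BirchSwinnertonDyer.BirchSwinnertonDyer.Theorems.ManinLocalTwoThreeVertexTwo
import Summits.BirchSwinnertonDyer.BirchSwinnertonDyer.Theorems.ManinLocalTwoThreeAtkinLehnerStepHolds
import Summits.BirchSwinnertonDyer.BirchSwinnertonDyer.Theorems.ManinLocalTwoThreeGenerationTwoParabolicExact
import Summits.BirchSwinnertonDyer.Rank1Residual.ManinAdditive.RelativeIharaShiftVanishingParabolic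
import Summits.BirchSwinnertonDyer.Rank1Residual.ManinAdditive.NotTrivialEisensteinOfIrreducible
import Literature.NumberTheory.EllipticCurves.Gamma0AwayCharacterExtension
import Literature.GroupTheory.SpecificGroups.SL2OddPrimeStableCharacterExtensionForms
import HarnessLib

/-!
# E-es-36x BY NAME from the two Literature facts, and the `C₃`-residual generation modulo the named leaves

Summit `BirchSwinnertonDyer`, route `ManinLocalTwoThree` (cell bsd-f2-manin), crux C2 `ManinOddAtFour` (stmt-BirchSwinnertonDyer-22967),
line `kato_shift_two` v6, stub 3 `stub_cThreeImageResidual` (the 3 950 `C₃`-image classes); MEMO-es §25 complete chain.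

* **`relativeIharaShiftVanishingParOddExact_two_of_facts (h27) (h43) (t n) : RelativeIharaShiftVanishingParOddExact 2 t n`** —
  -ty's leaf E-es-36x (p605979) for EVERY prime `t` and every `n`, from the two Literature facts F-es-27′
  `sl2ZModOddPrime_existsUnique_extension_of_stable_character` (Fiedorowicz–Priddy + Hochschild–Serre, used for odd `t` only)
  and E-es-43 `gamma0Away_character_extension_of_shiftInvariant` (Serre's amalgam).  Composition: `oddShiftReduction` (p1) ∘
  [`t` odd: `shiftInvariantIsOldUpToDiamond_odd_of_extensionFact` (p3) | `t = 2`: `shiftInvariantIsOldUpToDiamondMin_two` (p2)]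
  ∘ `atkinLehnerStep_holds` (p1/p2) ∘ `eq_zero_of_vertexInputs` (p3) — all through `relativeIharaParOddExact_two_of_vertexBodies`.
* **`multiShiftClassGenerationTwo_of_parOdd_facts`** — E-es-22 `MultiShiftClassGenerationTwo` (= the registered stub
  `stub_cThreeImageResidual`'s content for all `W[2]`-irreducible classes) from: the leaf E-es-36o `RelativeIharaShiftVanishingParOdd 2 2 3`
  (open: its `k ≥ 2` part is the lead's E-es-37 descent), the two Literature facts above, and the two Chebotarev leaves E-es-40₂ /
  E-es-40 (`NotTrivialEisensteinOfIrreducibleAtTwo`, `NotTrivialEisensteinOfIrreducibleTwo`, p605991) — via the consumer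
  `multiShiftClassGenerationTwo_of_parabolicVanishing_exact` (p605607).

No new definitions; nothing about BSD or Manin's conjecture is proved here (every input named above is a hypothesis).
-/

set_option autoImplicit false
set_option linter.dupNamespace false

noncomputable section

open scoped MatrixGroups

open CongruenceSubgroup Literature.NumberTheory.EllipticCurves.ModularForms
  Literature.NumberTheory.EllipticCurves.ModularForms.HidaCohomology
  Summit.BirchSwinnertonDyer.BirchSwinnertonDyer.Theorems.ConjSpanGenAllLevels
  Summit.BirchSwinnertonDyer.Rank1Residual.ManinAdditive
  Literature.NumberTheory.EllipticCurves Literature.GroupTheory.SpecificGroups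

namespace Summit.BirchSwinnertonDyer.BirchSwinnertonDyer.Theorems.ManinLocalTwoThree

/-- **E-es-36x `RelativeIharaShiftVanishingParOddExact 2 t n` from the two Literature facts** (F-es-27′ for odd `t`; E-es-43
for every `t`): for every prime `t`, odd `n`, level `L` with `t ∥ L`, a parabolic generalised eigen-homomorphism on `Γ₀(L)` over
a field of characteristic `2` with hNT(`t`) which is `tⁿ`-shift-invariant vanishes. [cite: Shimura1971, §8.3 (8.3.2)] -/
theorem relativeIharaShiftVanishingParOddExact_two_of_facts
    (h27 : sl2ZModOddPrime_existsUnique_extension_of_stable_character)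
    (h43 : gamma0Away_character_extension_of_shiftInvariant) (t n : ℕ) :
    RelativeIharaShiftVanishingParOddExact 2 t n := by
  -- E-es-43 in the `Delta`/`iota` spelling
  have h43' : t.Prime →
      ∀ (K : Type) [Field K] (L' : ℕ) [NeZero L'] [NeZero t], ¬ t ∣ L' →
      ∀ u : cocycles 0 L' K,
        degeneracyPullback 0 L' (L' * t) t K dvd_rfl (u : Gamma0 L' → Fin 1 → K) =
          degeneracyPullback 0 L' (L' * t) 1 K (by simp) (u : Gamma0 L' → Fin 1 → K) →
        ∃ Φ : SL(2, Away t) → K,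
          (∀ g ∈ Delta t L', ∀ g' ∈ Delta t L', Φ (g * g') = Φ g + Φ g') ∧
          ∀ γ : Gamma0 L', Φ (iota t (γ : SL(2, ℤ))) = (u : Gamma0 L' → Fin 1 → K) γ 0 := by
    intro ht K _ L' _ _ hL' u hsh
    obtain ⟨Φ, hadd, hι⟩ := h43 t ht K L' hL' u hsh
    exact ⟨Φ, fun g hg g' hg' => hadd g hg g' hg', hι⟩
  by_cases ht2 : t = 2
  · subst ht2
    exact relativeIharaParOddExact_two_of_vertexBodies 2 n
      (shiftInvariantIsOldUpToDiamondMin_two (p := 2) (by decide)) (atkinLehnerStep_holds 2 2) h43'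
  · refine relativeIharaParOddExact_two_of_vertexBodies t n ?_ (atkinLehnerStep_holds 2 t) h43'
    intro _ ht K _ _ L' _ _ hL' u hshift
    exact shiftInvariantIsOldUpToDiamond_odd_of_extensionFact ht ht2
      (exists_additive_extension_of_sl2ZModOddPrime_quotient_charTwo h27 t ht ht2) hL' u hshift

/-- **E-es-22 for all `W[2]`-irreducible classes (`stub_cThreeImageResidual` included) modulo the named leaves and facts**:
E-es-36o at `(2,2,3)` (leaf; `k ≥ 2` = E-es-37 pending), F-es-27′ and E-es-43 (Literature facts), E-es-40₂ / E-es-40 (Chebotarev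
leaves). [cite: Shimura1971, §8.3 (8.3.2)] -/
theorem multiShiftClassGenerationTwo_of_parOdd_facts
    (h8 : RelativeIharaShiftVanishingParOdd 2 2 3)
    (h27 : sl2ZModOddPrime_existsUnique_extension_of_stable_character)
    (h43 : gamma0Away_character_extension_of_shiftInvariant)
    (hNT2 : NotTrivialEisensteinOfIrreducibleAtTwo) (hNT : NotTrivialEisensteinOfIrreducibleTwo) :
    MultiShiftClassGenerationTwo := by
  refine multiShiftClassGenerationTwo_of_parabolicVanishing_exact ?_ ?_
  · intro W _ hirr L' _ S v hS hv hvp heq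
    exact h8 Nat.prime_two Nat.prime_two ⟨1, rfl⟩ (ZMod 2) L' S (fun ℓ : ℕ => ((W.LFunction ℓ : ℤ) : ZMod 2)) v hS hv
      (fun M => hNT2 W hirr S M) (fun γ c hc => funext fun i => by rw [Fin.eq_zero i]; exact hvp γ c hc) heq
  · intro W _ N _ f hf hirr t ht ht2 _ htsq L' _ _ S v _ htL' htsqL' hS hv hvp heq
    exact relativeIharaShiftVanishingParOddExact_two_of_facts h27 h43 t 1 Nat.prime_two ht ⟨0, rfl⟩ (ZMod 2) L' S
      (fun ℓ : ℕ => ((W.LFunction ℓ : ℤ) : ZMod 2)) v htL' htsqL' hS hv (fun M => hNT W f hf hirr t ht (Or.inr htsq) S M)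
      (fun γ c hc => funext fun i => by rw [Fin.eq_zero i]; exact hvp γ c hc) heq

end Summit.BirchSwinnertonDyer.BirchSwinnertonDyer.Theorems.ManinLocalTwoThree

end
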